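import Summits.BirchSwinnertonDyer.Rank1Residual.Additive.X3BranchGordEndStateOfFacts
import Summits.BirchSwinnertonDyer.Rank1Residual.Additive.X3ThreeLineDatumEndState
import Summits.BirchSwinnertonDyer.Rank1Residual.Additive.CycLeadingTermDvdIff
import Summits.BirchSwinnertonDyer.Rank1Residual.Additive.LocalTowerKernelAtPTwistedOrdinaryTwo
import Summits.BirchSwinnertonDyer.Rank1Residual.Additive.GordThreeCycLowerCore
import Literature.NumberTheory.EllipticCurves.Delbourgo1998.RankZeroLeadingTermExactPotGoodOrd
import HarnessLib

/-!
# X3♯(G-ord, `e = 2`) at analytic rank `0`, ANOMALOUS ROWS INCLUDED: `MissingLowerBoundAt W p` and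
# `BSD(E,p)` from PUBLISHED facts + the line datum, with Delbourgo 1998 Prop. 4 read INTRINSICALLY
# (the local factor at `p` = the order of the local tower kernel, which VANISHES on the (G-ord) rows)
# — the hypotheses `hna : ReductionNonAnomalous W p` and `hcm : ¬ HasCM` of the end states of
# `X3BranchGordEndStateOfFacts.lean` / `…ThreeOfLiftingFact.lean` DELETED (cell `bsd-addord`, seat
# `bsd-addord-twist`, strategy = twist transport; planner ruling TARGET.md S39″ route R0-H¹, item (H1-c))

HONEST FRAMING (cell `bsd-addord`, `run/shared/lean/pub/bsd-addord/README.md` §4): the programme's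
target of record is the full Birch–Swinnerton-Dyer formula for every `E/ℚ` of analytic rank `≤ 1`;
this file concerns the X3 rows (`E[p]` reducible) of N10's semistable-twist locus, cell (G-ord, `e = 2`),
`r_an = 0`, on the branch-parity line position — NOW WITHOUT the non-anomalous proviso. THEOREMS ONLY
(no `def`, no named fact, no `sorry`); nothing is booked by this file (planner's / referee's call:
ONE (T4) memo + referee pass before any anomalous booking, S39″). Every hypothesis that is not a
class / line binder is a PUBLISHED named fact of the tree: `hW16` (Wuthrich 2014 Thm. 16), `hGV`
(GV 2000 Thm. (3.12), reading p396718), `h23`, `h414`, `hGrK`, `hLiftF` / `hLiftE` (GV pp. 28/30),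
**`hDelG := Delbourgo1998.prop4_rankZero_constantCoeff_eq_unit_mul_of_potGoodOrd`** (De98 Thm. 3 +
Prop. 4 in the paper's OWN currency — the 𝔭-factor INTRINSIC as `Nat.card (W.localTowerKerPrimary κ ℚ_v 0)`;
literature seat's (H1-b), referee (c6) PASS, p404164), `hDel98` (De98 Prop. 4 weak form, for the upper
half), `hGZK`, `hmod`, `hmodD`.

## What and why

The accepted end states `ClassX3Gord.{missingLowerBoundAt,bsdp}_rankZero_of_facts_of_nonAnomalous`
(p401882) and their `p = 3` twins (p402517, p403617) read the algebraic leading term through Delbourgo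
2002 Thm. (B), whose factor `ℓ_p(E)` the tree transcribes as "`ℓ ∣ p²`, `= 1` off the anomalous rows"
— hence `hna`. On the (G-ord) rows the INTRINSIC factor is trivial: the tree's kernel theorem
`GoodModelLine.ClassX3Gord.localTowerKerPrimary_zero_eq_bot` (n1011 T-T3B,
`Additive/LocalTowerKernelAtPTwistedOrdinaryTwo.lean`: Greenberg's Lemma 3.4 at level `0` with both
anomalous factors `= 1`, the étale quotient carrying a RAMIFIED character) gives
`W.localTowerKerPrimary κ ℚ_v 0 = ⊥` at every odd `p`, anomalous twist or not. So De98 Prop. 4 in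
intrinsic form (`hDelG`) yields the tree's typed EXACT leading term `ExactLeadingTermAt W p`
(§1, `ClassX3Gord.exactLeadingTermAt_of_prop4Intrinsic`), and the cell's existing `_of_exact`
consumers (`ClassX3Gord.missingLowerBoundAt_rankZero_of_cycLowerLeadingTerm_of_exact`,
`Additive/CycLeadingTermDvdIff.lean`) turn this seat's PUBLISHED-facts `CycLowerLeadingTermAt W p`
(`ClassX3Gord.cycLowerLeadingTermAt_of_facts[_of_lifting]`) into the lower half with NO `hna` and
NO `hcm` (§2); the upper half is unchanged (Wuthrich component + De98 Prop. 4 weak form at `p ≥ 5`,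
`AdditivePotMult.ClassX3Gord.missingUpperBoundAt_three_rankZero` at `p = 3`), whence `BSDp W p` (§3).
Reach: the 225 anomalous r0 ¬CM keys of `HOME/planner/bx3g/anomalous_keys_225.tsv` join the 599 —
824 classes, each through its Case-1 member (member table `HOME/bsd-addord-twist-booking-members.tsv`;
at `p = 3` the kernel records `X3ThreeLineDatumRecords.x3LineDatumThree_<label>` cover all 685).

References: [Delbourgo1998] Thm. 3 (p. 143), Prop. 4 (p. 144), p. 138; [GreenbergLNM1716] §3 Lemma 3.4
(p. 89), Prop. 3.8 (p. 95); [GreenbergVatsal2000] §2 (11), (16), pp. 28–30, §3 Thm. (3.12); [Wuthrich2014]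
Thm. 16; [Pal2012] Thm. 3.2; [Miller2011LMS] Def. 1.1.
-/

set_option autoImplicit false

noncomputable section

open scoped Classical MatrixGroups ModularForm

namespace Summit.BirchSwinnertonDyer.Rank1Residual.Additive

open CongruenceSubgroup WeierstrassCurve NumberField IsDedekindDomain Field
  Literature.NumberTheory.EllipticCurves
  Literature.NumberTheory.EllipticCurves.ModularForms
  Literature.NumberTheory.EllipticCurves.GreenbergVatsal2000
  Literature.NumberTheory.EllipticCurves.Rank1Residual
  Literature.NumberTheory.EllipticCurves.Rank1Residual.Typed
  Literature.NumberTheory.GaloisRepresentations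
  Summit.BirchSwinnertonDyer.Rank1Residual.X1.MuLambda
  Summit.BirchSwinnertonDyer.Rank1Residual.AdditivePotMult
  Summit.BirchSwinnertonDyer.Rank1Residual.Additive.X3Branch

variable {W : WeierstrassCurve ℚ} [W.IsElliptic] [W.IsGloballyMinimal] {p : ℕ} [hp : Fact p.Prime]

/-! ### §1 The EXACT leading term on X3♯(G-ord) from De98 Prop. 4 intrinsic + the local tower kernel -/

/-- **`ExactLeadingTermAt W p` on X3♯(G-ord), every odd `p`, `r_an = 0` — anomalous rows included.**
Delbourgo 1998 Prop. 4 in intrinsic form (`hDelG`: `g(0)·#E(ℚ)² = u·#Ш[p^∞]·#𝒦₀·∏_{ν≠p} c_ν` with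
`𝒦₀ = W.localTowerKerPrimary κ ℚ_v 0`) and the tree's kernel theorem
`GoodModelLine.ClassX3Gord.localTowerKerPrimary_zero_eq_bot` (`𝒦₀ = ⊥`, so `#𝒦₀ = 1`); `E(ℚ)`, `Ш`
finite by GZK. [cite: Delbourgo1998, Thm. 3 (p. 143) and Prop. 4 (p. 144)]
[cite: GreenbergLNM1716, §3 Lemma 3.4 (p. 89) and Prop. 3.8 (p. 95)] -/
theorem ClassX3Gord.exactLeadingTermAt_of_prop4Intrinsic
    (hDelG : Delbourgo1998.prop4_rankZero_constantCoeff_eq_unit_mul_of_potGoodOrd)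
    (hGZK : rank_eq_analyticRank_of_analyticRank_le_one)
    (hp2 : p ≠ 2) (hX : ClassX3Gord W p) (hr : W.analyticRank = 0) :
    ExactLeadingTermAt W p := by
  intro κ γ hκ hγ D
  obtain ⟨hmw, hfin⟩ := hGZK W (by rw [hr]; exact zero_le_one)
  have hmw0 : W.mordellWeilRank = 0 := by rw [hmw, hr]
  haveI : Finite W.sha := hfin
  haveI hE : Finite W.toAffine.Point := W.finite_point_of_rank_zero hmw0
  obtain ⟨v, hv⟩ := exists_heightOneSpectrum_natCast_mem ℚ p
  obtain ⟨-, -, g, hgmem, -, u, hgeq⟩ := hDelG W p hp2 hX.addv hX.typeGOrd hr hfin hE κ γ hκ hγ v hv D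
  have hbot := GoodModelLine.ClassX3Gord.localTowerKerPrimary_zero_eq_bot (W := W) (p := p) hp2 hX hv κ
  have hcard : Nat.card (W.localTowerKerPrimary κ (v.adicCompletion ℚ) 0) = 1 := by
    rw [hbot]; exact AddSubgroup.card_bot
  rw [hcard, Nat.cast_one, mul_one] at hgeq
  exact ⟨g, hgmem, u, hgeq⟩

/-! ### §2 The LOWER half without `hna` / `hcm` (`p ≥ 5` with `hLiftF`; `p = 3` with `hLiftE`) -/

/-- **X3♯(G-ord) ∩ `I₀*`, `p ≥ 5`, `r_an = 0`, on the branch-parity line position — ANOMALOUS ROWS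
INCLUDED, CM not excluded: `Typed.MissingLowerBoundAt W p` FROM PUBLISHED FACTS ONLY** + the per-pair
line datum `Φ₀` (rational, ramified at `p`, even, `χ`-twist ramified). Binder diff w.r.t. p401882's
`…_of_facts_of_nonAnomalous`: {`hDel`, `hcm`, `hna`} ↦ {`hDelG`}.
[cite: Delbourgo1998, Prop. 4 (p. 144)] [cite: GreenbergLNM1716, §3 Lemma 3.4 (p. 89)]
[cite: GreenbergVatsal2000, §2 (11), (16), §3 Thm. (3.12) p. 45] [cite: Wuthrich2014, Thm. 16 (p. 397)]
[cite: Pal2012, Thm. 3.2] [cite: Miller2011LMS, Def. 1.1] -/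
theorem ClassX3Gord.missingLowerBoundAt_rankZero_of_facts_intrinsic
    (hW16 : Wuthrich2014.thm16_halfEigenCharIdeal_dvd_cyclotomicPrime)
    (hGV : thm312_branch_unitContent_and_lambda_eq_residual_goodOrd)
    (h23 : datumSelmer_nonPrimitive_invariants)
    (h414 : Greenberg1999.prop414_noFiniteSubmodule_of_not_dvd_torsionOrder)
    (hGrK : Greenberg1999.imKummer_ge_strictCondition_goodOrdinary)
    (hLiftF : residualEpsilon_surjOn_of_lineRamifiedEven)
    (hDelG : Delbourgo1998.prop4_rankZero_constantCoeff_eq_unit_mul_of_potGoodOrd)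
    (hGZK : rank_eq_analyticRank_of_analyticRank_le_one) (hmod : hasEntireLFunction_rat)
    (hmodD : nonempty_modularParametrizationData)
    (hX : ClassX3Gord W p) (hp2 : p ≠ 2) (he : semistabilityIndex W p = 2) (hr : W.analyticRank = 0)
    (Φ₀ : AddSubgroup (W.geomTorsion (p : ℤ))) (hΦ : IsRationalLine W p Φ₀)
    (hram0 : ¬ LineUnramifiedAt W p Φ₀) (heven : LineEven W p Φ₀)
    (hram : ∀ (K : Type) [Field K] [NumberField K] [(galRange (K := ℚ) K).Normal],
      Module.finrank ℚ K = 2 → (∃ θ : K, θ ^ 2 = algebraMap ℚ K ((-1) ^ (p / 2) * p)) →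
      ¬ ∀ v : HeightOneSpectrum (𝓞 ℚ), ((p : ℕ) : 𝓞 ℚ) ∈ v.asIdeal →
        ∀ 𝔓 ∈ v.primesAbove, ∀ σ ∈ 𝔓.inertia (absoluteGaloisGroup ℚ), ∀ P ∈ Φ₀,
          σ • P = (if σ ∈ galRange (K := ℚ) K then P else -P)) :
    MissingLowerBoundAt W p :=
  ClassX3Gord.missingLowerBoundAt_rankZero_of_cycLowerLeadingTerm_of_exact hGZK hmod hX hr
    (ClassX3Gord.cycLowerLeadingTermAt_of_facts hW16 hGV h23 h414 hGrK hLiftF hmod hmodD hX hp2 he Φ₀ hΦ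
      hram0 heven hram)
    (ClassX3Gord.exactLeadingTermAt_of_prop4Intrinsic hDelG hGZK hp2 hX hr)

/-- **X3♯(G-ord) ∩ `I₀*` at `p = 3`, `r_an = 0` — ANOMALOUS ROWS INCLUDED: `Typed.MissingLowerBoundAt W 3`
FROM PUBLISHED FACTS ONLY + the line datum** (rational, EVEN, non-trivial `Γ_ℚ`-action, `χ_{−3}`-twist
ramified), the lifting supplied by the reading-fact `hLiftE` (GV p. 28 with p. 30). Binder diff w.r.t.
p402517's `…_three_rankZero_of_facts_of_nonAnomalous`: {`hDel3`, `hcm`, `hna`} ↦ {`hDelG`}.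
[cite: Delbourgo1998, Prop. 4 (p. 144)] [cite: GreenbergLNM1716, §3 Lemma 3.4 (p. 89)]
[cite: GreenbergVatsal2000, §2 (11), (16), pp. 28–30, §3 Thm. (3.12)] [cite: Wuthrich2014, Thm. 16 (p. 397)]
[cite: Miller2011LMS, Def. 1.1] -/
theorem ClassX3Gord.missingLowerBoundAt_three_rankZero_of_facts_intrinsic [Fact (Nat.Prime 3)]
    {W : WeierstrassCurve ℚ} [W.IsElliptic] [W.IsGloballyMinimal]
    (hW16 : Wuthrich2014.thm16_halfEigenCharIdeal_dvd_cyclotomicPrime)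
    (hGV : thm312_branch_unitContent_and_lambda_eq_residual_goodOrd)
    (h23 : datumSelmer_nonPrimitive_invariants)
    (h414 : Greenberg1999.prop414_noFiniteSubmodule_of_not_dvd_torsionOrder)
    (hGrK : Greenberg1999.imKummer_ge_strictCondition_goodOrdinary)
    (hLiftE : residualEpsilon_surjOn_of_lineEven)
    (hDelG : Delbourgo1998.prop4_rankZero_constantCoeff_eq_unit_mul_of_potGoodOrd)
    (hGZK : rank_eq_analyticRank_of_analyticRank_le_one) (hmod : hasEntireLFunction_rat)
    (hmodD : nonempty_modularParametrizationData)
    (hX : ClassX3Gord W 3) (hr : W.analyticRank = 0)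
    (Φ₀ : AddSubgroup (W.geomTorsion ((3 : ℕ) : ℤ))) (hΦ : IsRationalLine W 3 Φ₀)
    (heven : LineEven W 3 Φ₀)
    (hnt : ∃ (σ : absoluteGaloisGroup ℚ) (P : W.geomTorsion ((3 : ℕ) : ℤ)), P ∈ Φ₀ ∧ σ • P ≠ P)
    (hram : ∀ (K : Type) [Field K] [NumberField K] [(galRange (K := ℚ) K).Normal],
      Module.finrank ℚ K = 2 →
      (∃ θ : K, θ ^ 2 = algebraMap ℚ K ((-1) ^ ((3 : ℕ) / 2) * (3 : ℕ))) →
      ¬ ∀ v : HeightOneSpectrum (𝓞 ℚ), (((3 : ℕ) : ℕ) : 𝓞 ℚ) ∈ v.asIdeal →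
        ∀ 𝔓 ∈ v.primesAbove, ∀ σ ∈ 𝔓.inertia (absoluteGaloisGroup ℚ), ∀ P ∈ Φ₀,
          σ • P = (if σ ∈ galRange (K := ℚ) K then P else -P)) :
    MissingLowerBoundAt W 3 :=
  ClassX3Gord.missingLowerBoundAt_rankZero_of_cycLowerLeadingTerm_of_exact hGZK hmod hX hr
    (ClassX3Gord.cycLowerLeadingTermAt_of_facts_of_lifting hW16 hGV h23 h414 hGrK hmod hmodD hX
      (by norm_num) (semistabilityIndex_eq_two_of_typeG_three W hX.typeGOrd.typeG hX.addv) Φ₀ hΦ heven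
      hnt hram (fun κ S₀ hκ hS₀ hS ↦ hLiftE W 3 κ S₀ Φ₀ hΦ (by norm_num) hκ heven hS₀ hS))
    (ClassX3Gord.exactLeadingTermAt_of_prop4Intrinsic hDelG hGZK (by norm_num) hX hr)

/-! ### §3 `BSD(E,p)` without `hna` / `hcm` -/

/-- **X3♯(G-ord) ∩ `I₀*`, `p ≥ 5`, `r_an = 0`, ANOMALOUS ROWS INCLUDED: Miller's `BSD(E,p)` FROM
PUBLISHED FACTS ONLY + the line datum.** Lower half: §2; upper half: Wuthrich's component divisibility
(from `hW16`) + De98 Prop. 4 weak form (`hDel98`) + Pal (tree theorem), as in p401882. Binder diff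
w.r.t. `ClassX3Gord.bsdp_rankZero_of_facts_of_nonAnomalous`: {`hDel`, `hcm`, `hna`} ↦ {`hDelG`}.
[cite: Delbourgo1998, Prop. 4 (p. 144)] [cite: GreenbergLNM1716, §3 Lemma 3.4 (p. 89)]
[cite: Wuthrich2014, Thm. 16 (p. 397)] [cite: GreenbergVatsal2000, §2 (11), (16), §3 Thm. (3.12) p. 45]
[cite: Pal2012, Thm. 3.2] [cite: Miller2011LMS, §1 and Def. 1.1] -/
theorem ClassX3Gord.bsdp_rankZero_of_facts_intrinsic
    (hW16 : Wuthrich2014.thm16_halfEigenCharIdeal_dvd_cyclotomicPrime)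
    (hGV : thm312_branch_unitContent_and_lambda_eq_residual_goodOrd)
    (h23 : datumSelmer_nonPrimitive_invariants)
    (h414 : Greenberg1999.prop414_noFiniteSubmodule_of_not_dvd_torsionOrder)
    (hGrK : Greenberg1999.imKummer_ge_strictCondition_goodOrdinary)
    (hLiftF : residualEpsilon_surjOn_of_lineRamifiedEven)
    (hDelG : Delbourgo1998.prop4_rankZero_constantCoeff_eq_unit_mul_of_potGoodOrd)
    (hDel98 : Delbourgo1998.prop4_rankZero_pow_dvd_constantCoeff)
    (hGZK : rank_eq_analyticRank_of_analyticRank_le_one) (hmod : hasEntireLFunction_rat)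
    (hmodD : nonempty_modularParametrizationData)
    (hX : ClassX3Gord W p) (hp5 : 5 ≤ p) (he : semistabilityIndex W p = 2) (hr : W.analyticRank = 0)
    (Φ₀ : AddSubgroup (W.geomTorsion (p : ℤ))) (hΦ : IsRationalLine W p Φ₀)
    (hram0 : ¬ LineUnramifiedAt W p Φ₀) (heven : LineEven W p Φ₀)
    (hram : ∀ (K : Type) [Field K] [NumberField K] [(galRange (K := ℚ) K).Normal],
      Module.finrank ℚ K = 2 → (∃ θ : K, θ ^ 2 = algebraMap ℚ K ((-1) ^ (p / 2) * p)) →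
      ¬ ∀ v : HeightOneSpectrum (𝓞 ℚ), ((p : ℕ) : 𝓞 ℚ) ∈ v.asIdeal →
        ∀ 𝔓 ∈ v.primesAbove, ∀ σ ∈ 𝔓.inertia (absoluteGaloisGroup ℚ), ∀ P ∈ Φ₀,
          σ • P = (if σ ∈ galRange (K := ℚ) K then P else -P)) :
    BSDp W p :=
  bsdp_of_missingPPartAt W p hGZK (by rw [hr]; exact zero_le_one)
    (missingPPartAt_of_lower_of_upper W p
      (ClassX3Gord.missingLowerBoundAt_rankZero_of_facts_intrinsic hW16 hGV h23 h414 hGrK hLiftF hDelG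
        hGZK hmod hmodD hX (by omega) he hr Φ₀ hΦ hram0 heven hram)
      (ClassX3Gord.missingUpperBoundAt_rankZero_of_cycLeadingTerm hDel98 hGZK hmod hX hp5 hr
        (ClassX3Gord.cycLeadingTermAt_of_wuthrichComponent W p
          (Wuthrich2014.charIdeal_dvd_padicLFunctionBranch_component_of_half hW16)
          pal2012_thm32_sqrt_mul_realPeriodRat_twist_eq_of_prime_one_mod_four_holds hmod hmodD
          (by omega) hX he)))

/-- **X3♯(G-ord) ∩ `I₀*` at `p = 3`, `r_an = 0`, ANOMALOUS ROWS INCLUDED: Miller's `BSD(E,3)` FROM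
PUBLISHED FACTS ONLY + the line datum.** Lower half: §2 (`hLiftE`); upper half: Wuthrich Thm. 16 on the
minus-eigenspace at `3` + De98 Prop. 4 weak form (`AdditivePotMult.ClassX3Gord.missingUpperBoundAt_three_rankZero`).
Binder diff w.r.t. p402517's `ClassX3Gord.bsdp_three_rankZero_of_facts_of_nonAnomalous`:
{`hDel3`, `hcm`, `hna`} ↦ {`hDelG`}. [cite: Delbourgo1998, Prop. 4 (p. 144)]
[cite: GreenbergLNM1716, §3 Lemma 3.4 (p. 89)] [cite: Wuthrich2014, Thm. 16 (p. 397)]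
[cite: GreenbergVatsal2000, §2 (11), (16), pp. 28–30] [cite: Miller2011LMS, §1 and Def. 1.1] -/
theorem ClassX3Gord.bsdp_three_rankZero_of_facts_intrinsic [Fact (Nat.Prime 3)]
    {W : WeierstrassCurve ℚ} [W.IsElliptic] [W.IsGloballyMinimal]
    (hW16 : Wuthrich2014.thm16_halfEigenCharIdeal_dvd_cyclotomicPrime)
    (hGV : thm312_branch_unitContent_and_lambda_eq_residual_goodOrd)
    (h23 : datumSelmer_nonPrimitive_invariants)
    (h414 : Greenberg1999.prop414_noFiniteSubmodule_of_not_dvd_torsionOrder)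
    (hGrK : Greenberg1999.imKummer_ge_strictCondition_goodOrdinary)
    (hLiftE : residualEpsilon_surjOn_of_lineEven)
    (hDelG : Delbourgo1998.prop4_rankZero_constantCoeff_eq_unit_mul_of_potGoodOrd)
    (hDel98 : Delbourgo1998.prop4_rankZero_pow_dvd_constantCoeff)
    (hGZK : rank_eq_analyticRank_of_analyticRank_le_one) (hmod : hasEntireLFunction_rat)
    (hmodD : nonempty_modularParametrizationData)
    (hX : ClassX3Gord W 3) (hr : W.analyticRank = 0)
    (Φ₀ : AddSubgroup (W.geomTorsion ((3 : ℕ) : ℤ))) (hΦ : IsRationalLine W 3 Φ₀)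
    (heven : LineEven W 3 Φ₀)
    (hnt : ∃ (σ : absoluteGaloisGroup ℚ) (P : W.geomTorsion ((3 : ℕ) : ℤ)), P ∈ Φ₀ ∧ σ • P ≠ P)
    (hram : ∀ (K : Type) [Field K] [NumberField K] [(galRange (K := ℚ) K).Normal],
      Module.finrank ℚ K = 2 →
      (∃ θ : K, θ ^ 2 = algebraMap ℚ K ((-1) ^ ((3 : ℕ) / 2) * (3 : ℕ))) →
      ¬ ∀ v : HeightOneSpectrum (𝓞 ℚ), (((3 : ℕ) : ℕ) : 𝓞 ℚ) ∈ v.asIdeal →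
        ∀ 𝔓 ∈ v.primesAbove, ∀ σ ∈ 𝔓.inertia (absoluteGaloisGroup ℚ), ∀ P ∈ Φ₀,
          σ • P = (if σ ∈ galRange (K := ℚ) K then P else -P)) :
    BSDp W 3 :=
  bsdp_of_missingPPartAt W 3 hGZK (by rw [hr]; exact zero_le_one)
    (missingPPartAt_of_lower_of_upper W 3
      (ClassX3Gord.missingLowerBoundAt_three_rankZero_of_facts_intrinsic hW16 hGV h23 h414 hGrK hLiftE
        hDelG hGZK hmod hmodD hX hr Φ₀ hΦ heven hnt hram)
      (AdditivePotMult.ClassX3Gord.missingUpperBoundAt_three_rankZero hDel98 hGZK hmod hmodD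
        (thm16_minusEigenCharIdeal_dvd_cyclotomicThree_of_half hW16) hX
        (semistabilityIndex_eq_two_of_typeG_three W hX.typeGOrd.typeG hX.addv) hr))

/-- **`p = 3` with the line datum as ONE predicate** (per-pair records `x3LineDatumThree_<label>`):
`BSD(E,3)` on X3♯(G-ord, `e = 2`) ∩ r0, anomalous rows included.
[cite: Delbourgo1998, Prop. 4 (p. 144)] [cite: GreenbergLNM1716, §3 Lemma 3.4 (p. 89)]
[cite: Wuthrich2014, Thm. 16 (p. 397)] [cite: Miller2011LMS, §1 and Def. 1.1] -/
theorem ClassX3Gord.bsdp_three_rankZero_of_facts_of_lineDatum_intrinsic [Fact (Nat.Prime 3)]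
    {W : WeierstrassCurve ℚ} [W.IsElliptic] [W.IsGloballyMinimal]
    (hW16 : Wuthrich2014.thm16_halfEigenCharIdeal_dvd_cyclotomicPrime)
    (hGV : thm312_branch_unitContent_and_lambda_eq_residual_goodOrd)
    (h23 : datumSelmer_nonPrimitive_invariants)
    (h414 : Greenberg1999.prop414_noFiniteSubmodule_of_not_dvd_torsionOrder)
    (hGrK : Greenberg1999.imKummer_ge_strictCondition_goodOrdinary)
    (hLiftE : residualEpsilon_surjOn_of_lineEven)
    (hDelG : Delbourgo1998.prop4_rankZero_constantCoeff_eq_unit_mul_of_potGoodOrd)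
    (hDel98 : Delbourgo1998.prop4_rankZero_pow_dvd_constantCoeff)
    (hGZK : rank_eq_analyticRank_of_analyticRank_le_one) (hmod : hasEntireLFunction_rat)
    (hmodD : nonempty_modularParametrizationData)
    (hX : ClassX3Gord W 3) (hr : W.analyticRank = 0) (hL : X3LineDatumThree W) : BSDp W 3 := by
  obtain ⟨Φ₀, hΦ, heven, hnt, hram⟩ := hL
  exact ClassX3Gord.bsdp_three_rankZero_of_facts_intrinsic hW16 hGV h23 h414 hGrK hLiftE hDelG hDel98
    hGZK hmod hmodD hX hr Φ₀ hΦ heven hnt hram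

end Summit.BirchSwinnertonDyer.Rank1Residual.Additive

end
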